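import Summits.CriticalPhenomena.PercolationContinuityZ3.Theorems.PercNearOneGluingNoHeavyLowerTailCILUnionExchange
import Literature.Probability.Percolation.TwoSetExchange
import HarnessLib

/-!
# `NoHeavyLowerTail` (stmt-CriticalPhenomena-4575) — the two "Harris substitutes" of the union exchange
# with an avoided vertex (HQ1, HQ2)

Prover `prim-gen-induct` (gen 9), `--supports stmt-CriticalPhenomena-4575`.  No definitions, no named facts,
no sorries; standard axioms.

Setting (BLOBQUOTIENT.md §26–28 of the prover's notes): bond percolation `μ = prodBernoulli w` on a finite
vertex type, a source `s`, a second terminal `t`, an observer `x` and an AVOIDED vertex `a`; `C = C_s` is the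
open edge cluster of `s` (BHK), `𝒜` an arbitrary upper family of edge sets and `A = {C_s ∈ 𝒜}`;
`R₁ = {s ↮ a}`, `R₂ = {t ↮ a}`, `U = {x ↔ s} ∪ {x ↔ t}` ("`x ↔ W`"), `D_x = {x ↮ a}`.
In the world `R₁` Harris' inequality for `A` and `U` FAILS (the piece `{x ↔ t ↔ a}` of `U` is negatively
correlated with `A`).  The two inequalities below are the valid replacements used throughout the
avoided-vertex analysis of the union exchange (loc. cit. §27 (iv): "HQ1", K-mixing family; §28):

* `UnionExchange.cov_attachAvoid_nonneg` (HQ1):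
  `μ(R₁ ∩ A) · μ(R₁ ∩ (U ∩ D_x)) ≤ μ(R₁) · μ(R₁ ∩ (A ∩ (U ∩ D_x)))`,
  i.e. `Cov(𝒜, {x ↔ W, x ↮ a} | s ↮ a) ≥ 0`;
* `UnionExchange.cov_crossAttachAvoid_nonneg` (HQ2):
  `μ(R₁ ∩ A) · μ(R₁ ∩ ({x ↔ t} ∩ R₂)) ≤ μ(R₁) · μ(R₁ ∩ (A ∩ ({x ↔ t} ∩ R₂)))`,
  i.e. `Cov(𝒜, {x ↔ t, t ↮ a} | s ↮ a) ≥ 0`.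

Proofs (two lines each): positive association of the GLUED cluster `C_{s,x}` (resp. `C_{s,t}`) given that it
avoids `a` (van den Berg–Häggström–Kahn 2006, Thm. 2.1 with vertex sets, tree
`setTwoClusterExchange`), followed by the positive correlation of `A` with the decreasing-in-`C_a` event
`{x ↮ a}` (resp. `{t ↮ a}`) given `s ↮ a` (BHK Thm. 1.5, same tree lemma with `S = {s}`, `T = {a}`).
-/

noncomputable section

open MeasureTheory Set
open Literature.Probability.LatticeModels (prodBernoulli)
open Literature.Probability.Percolation Literature.Probability.Percolation.TwoSetExchange

namespace Summit.CriticalPhenomena.PercolationContinuityZ3.Theorems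

namespace UnionExchange

variable {V : Type*} [Fintype V]

omit [Fintype V] in
/-- The event `{C_s ∈ 𝒜}` (`𝒜` upper) is of type `(+)` for the pair `(C_S, C_T)` whenever `s ∈ S`:
it is closed under enlarging `⋃_{u ∈ S} C_u` (and any change of `C_T`). [folklore] -/
theorem typePlus_setOf_openEdgeCluster_mem (S T : Set V) {s : V} (hs : s ∈ S)
    {𝒜 : Set (Set (Sym2 V))} (h𝒜 : IsUpperSet 𝒜) ⦃ω ω' : BondConfig V⦄
    (hS : (⋃ u ∈ S, openEdgeCluster ω u) ⊆ (⋃ u ∈ S, openEdgeCluster ω' u))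
    (_hT : (⋃ u ∈ T, openEdgeCluster ω' u) ⊆ (⋃ u ∈ T, openEdgeCluster ω u))
    (h : ω ∈ {ω : BondConfig V | openEdgeCluster ω s ∈ 𝒜}) :
    ω' ∈ {ω : BondConfig V | openEdgeCluster ω s ∈ 𝒜} :=
  h𝒜 (openEdgeCluster_mono_of_biUnion hs hS) h

omit [Fintype V] in
/-- The separation event `{S ↮ T}` for `S = {s}`, `T = {a}` is `{s ↮ a}`. [folklore] -/
theorem sep_singleton_singleton (s a : V) :
    {ω : BondConfig V | ∀ u ∈ ({s} : Set V), ∀ v ∈ ({a} : Set V), ¬ (openGraph ω).Reachable u v} =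
      {ω : BondConfig V | ¬ (openGraph ω).Reachable s a} := by
  ext ω
  simp only [mem_setOf_eq, mem_singleton_iff, forall_eq]

omit [Fintype V] in
/-- The separation event `{S ↮ T}` for `S = {s, x}`, `T = {a}` is `{s ↮ a} ∩ {x ↮ a}`. [folklore] -/
theorem sep_pair_singleton (s x a : V) :
    {ω : BondConfig V | ∀ u ∈ ({s, x} : Set V), ∀ v ∈ ({a} : Set V), ¬ (openGraph ω).Reachable u v} =
      {ω : BondConfig V | ¬ (openGraph ω).Reachable s a} ∩ {ω | ¬ (openGraph ω).Reachable x a} := by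
  ext ω
  simp only [mem_setOf_eq, mem_insert_iff, mem_singleton_iff, forall_eq_or_imp, forall_eq, mem_inter_iff]

/-- **HQ1 — the first Harris substitute.**  With `R₁ = {s ↮ a}`, `A = {C_s ∈ 𝒜}` (`𝒜` upper),
`U = {x ↔ s} ∪ {x ↔ t}` and `D_x = {x ↮ a}`:
`μ(R₁ ∩ A) · μ(R₁ ∩ (U ∩ D_x)) ≤ μ(R₁) · μ(R₁ ∩ (A ∩ (U ∩ D_x)))`, i.e. in the world `s ↮ a` the up-set `𝒜`
of `C_s` is positively correlated with `{x ↔ W, x ↮ a}`.  Proof: `R₁ ∩ D_x = {C_{s,x} ↮ a}`; there `A` and `U`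
are increasing in the glued cluster `C_{s,x}`, so `μ(R₁D_x A) μ(R₁D_x U) ≤ μ(R₁D_x) μ(R₁D_x A U)` (BHK Thm. 2.1
with sets); and `μ(R₁ A) μ(R₁ D_x) ≤ μ(R₁) μ(R₁ A D_x)` (`A` increasing in `C_s`, `D_x` decreasing in `C_a`,
BHK Thm. 1.5 given `s ↮ a`); multiply and cancel `μ(R₁ ∩ D_x)`. -/
theorem cov_attachAvoid_nonneg (w : Sym2 V → unitInterval) (s t x a : V)
    {𝒜 : Set (Set (Sym2 V))} (h𝒜 : IsUpperSet 𝒜) :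
    (prodBernoulli w).real ({ω : BondConfig V | ¬ (openGraph ω).Reachable s a} ∩
        {ω | openEdgeCluster ω s ∈ 𝒜}) *
      (prodBernoulli w).real ({ω : BondConfig V | ¬ (openGraph ω).Reachable s a} ∩
        ((openConn x s ∪ openConn x t) ∩ {ω | ¬ (openGraph ω).Reachable x a})) ≤
    (prodBernoulli w).real {ω : BondConfig V | ¬ (openGraph ω).Reachable s a} *
      (prodBernoulli w).real ({ω : BondConfig V | ¬ (openGraph ω).Reachable s a} ∩
        ({ω | openEdgeCluster ω s ∈ 𝒜} ∩
          ((openConn x s ∪ openConn x t) ∩ {ω | ¬ (openGraph ω).Reachable x a}))) := by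
  classical
  set μ := prodBernoulli w with hμ
  set R₁ : Set (BondConfig V) := {ω | ¬ (openGraph ω).Reachable s a} with hR₁
  set Dx : Set (BondConfig V) := {ω | ¬ (openGraph ω).Reachable x a} with hDx
  set A : Set (BondConfig V) := {ω | openEdgeCluster ω s ∈ 𝒜} with hA
  set U : Set (BondConfig V) := openConn x s ∪ openConn x t with hU
  -- Step 1: glued PA in the world `{s,x} ↮ {a}` = `R₁ ∩ Dx`
  have hsS : s ∈ ({s, x} : Set V) := by simp
  have hxS : x ∈ ({s, x} : Set V) := by simp
  have haT : a ∈ ({a} : Set V) := by simp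
  have tA := typePlus_setOf_openEdgeCluster_mem ({s, x} : Set V) ({a} : Set V) hsS h𝒜
  have tU : ∀ ⦃ω ω' : BondConfig V⦄,
      (⋃ u ∈ ({s, x} : Set V), openEdgeCluster ω u) ⊆ (⋃ u ∈ ({s, x} : Set V), openEdgeCluster ω' u) →
      (⋃ u ∈ ({a} : Set V), openEdgeCluster ω' u) ⊆ (⋃ u ∈ ({a} : Set V), openEdgeCluster ω u) →
      ω ∈ U → ω' ∈ U := by
    intro ω ω' hS hT h
    rcases h with h | h
    · exact Or.inl (typePlus_openConn_of_mem ({s, x} : Set V) ({a} : Set V) hxS s hS hT h)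
    · exact Or.inr (typePlus_openConn_of_mem ({s, x} : Set V) ({a} : Set V) hxS t hS hT h)
  have h1 := setTwoClusterExchange w ({s, x} : Set V) ({a} : Set V)
    (A₁ := A) (A₂ := U) (B₁ := Set.univ) (B₂ := Set.univ) tA tU
    (fun _ _ _ _ h => h) (fun _ _ _ _ h => h)
  rw [sep_pair_singleton] at h1
  simp only [inter_univ] at h1
  -- h1 : μ((R₁ ∩ Dx) ∩ A) * μ((R₁ ∩ Dx) ∩ U) ≤ μ((R₁ ∩ Dx) ∩ (A ∩ U)) * μ(R₁ ∩ Dx)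
  -- Step 2: `A` and `Dx` positively correlated given `s ↮ a` (BHK 1.5: `{a ↮ x}` is of type (+) for (C_s, C_a))
  have hsS' : s ∈ ({s} : Set V) := by simp
  have tA' := typePlus_setOf_openEdgeCluster_mem ({s} : Set V) ({a} : Set V) hsS' h𝒜
  have tDx : ∀ ⦃ω ω' : BondConfig V⦄,
      (⋃ u ∈ ({s} : Set V), openEdgeCluster ω u) ⊆ (⋃ u ∈ ({s} : Set V), openEdgeCluster ω' u) →
      (⋃ u ∈ ({a} : Set V), openEdgeCluster ω' u) ⊆ (⋃ u ∈ ({a} : Set V), openEdgeCluster ω u) →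
      ω ∈ Dx → ω' ∈ Dx := by
    intro ω ω' hS hT h
    have h' : ω ∈ (openConn a x : Set (BondConfig V))ᶜ := fun hax => h (hax.symm)
    have := typePlus_not_openConn_of_mem ({s} : Set V) ({a} : Set V) haT x hS hT h'
    exact fun hxa => this hxa.symm
  have h2 := setTwoClusterExchange w ({s} : Set V) ({a} : Set V)
    (A₁ := A) (A₂ := Dx) (B₁ := Set.univ) (B₂ := Set.univ) tA' tDx
    (fun _ _ _ _ h => h) (fun _ _ _ _ h => h)
  rw [sep_singleton_singleton] at h2
  simp only [inter_univ] at h2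
  -- h2 : μ(R₁ ∩ A) * μ(R₁ ∩ Dx) ≤ μ(R₁ ∩ (A ∩ Dx)) * μ(R₁)
  simp only [← hμ, ← hR₁, ← hDx] at h1 h2
  -- normalise the sets
  have e1 : R₁ ∩ Dx ∩ A = R₁ ∩ (A ∩ Dx) := by
    rw [inter_assoc, inter_comm Dx A]
  have e2 : R₁ ∩ Dx ∩ U = R₁ ∩ (U ∩ Dx) := by
    rw [inter_assoc, inter_comm Dx U]
  have e3 : R₁ ∩ Dx ∩ (A ∩ U) = R₁ ∩ (A ∩ (U ∩ Dx)) := by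
    ext ω; simp only [mem_inter_iff]; tauto
  rw [e1, e2, e3] at h1
  -- combine: if μ(R₁ ∩ Dx) = 0 both sides of the goal vanish appropriately
  have hnn : ∀ E : Set (BondConfig V), 0 ≤ μ.real E := fun E => measureReal_nonneg
  by_cases h0 : μ.real (R₁ ∩ Dx) = 0
  · have z : μ.real (R₁ ∩ (U ∩ Dx)) = 0 := by
      apply measureReal_mono_null _ h0
      intro ω hω; exact ⟨hω.1, hω.2.2⟩
    rw [z, mul_zero]
    exact mul_nonneg (hnn _) (hnn _)
  · have hpos : 0 < μ.real (R₁ ∩ Dx) := lt_of_le_of_ne (hnn _) (Ne.symm h0)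
    -- μ(R₁A) μ(R₁(U∩Dx)) μ(R₁Dx) ≤ μ(R₁(A∩Dx)) μ(R₁) μ(R₁(U∩Dx)) ≤ μ(R₁) μ(R₁Dx) μ(R₁(A∩(U∩Dx)))
    have k1 := mul_le_mul_of_nonneg_right h2 (hnn (R₁ ∩ (U ∩ Dx)))
    have k2 := mul_le_mul_of_nonneg_left h1 (hnn R₁)
    have : μ.real (R₁ ∩ Dx) * (μ.real (R₁ ∩ A) * μ.real (R₁ ∩ (U ∩ Dx))) ≤
        μ.real (R₁ ∩ Dx) * (μ.real R₁ * μ.real (R₁ ∩ (A ∩ (U ∩ Dx)))) := by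
      nlinarith [k1, k2, hnn (R₁ ∩ A), hnn R₁]
    exact le_of_mul_le_mul_left this hpos

/-- **HQ2 — the second Harris substitute.**  With `R₁ = {s ↮ a}`, `R₂ = {t ↮ a}`, `A = {C_s ∈ 𝒜}`
(`𝒜` upper): `μ(R₁ ∩ A) · μ(R₁ ∩ ({x ↔ t} ∩ R₂)) ≤ μ(R₁) · μ(R₁ ∩ (A ∩ ({x ↔ t} ∩ R₂)))`, i.e. in the
world `s ↮ a` the up-set `𝒜` of `C_s` is positively correlated with `{x ↔ t, t ↮ a}` (although it is
NEGATIVELY correlated with `{x ↔ t}` alone when `t ↔ a` is allowed).  Proof: `R₁ ∩ R₂ = {C_{s,t} ↮ a}`; there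
`A` and `{x ↔ t}` are increasing in the glued cluster `C_{s,t}` (BHK Thm. 2.1 with sets); and
`μ(R₁ A) μ(R₁ R₂) ≤ μ(R₁) μ(R₁ A R₂)` (BHK Thm. 1.5 given `s ↮ a`, `R₂` decreasing in `C_a`). -/
theorem cov_crossAttachAvoid_nonneg (w : Sym2 V → unitInterval) (s t x a : V)
    {𝒜 : Set (Set (Sym2 V))} (h𝒜 : IsUpperSet 𝒜) :
    (prodBernoulli w).real ({ω : BondConfig V | ¬ (openGraph ω).Reachable s a} ∩
        {ω | openEdgeCluster ω s ∈ 𝒜}) *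
      (prodBernoulli w).real ({ω : BondConfig V | ¬ (openGraph ω).Reachable s a} ∩
        (openConn x t ∩ {ω | ¬ (openGraph ω).Reachable t a})) ≤
    (prodBernoulli w).real {ω : BondConfig V | ¬ (openGraph ω).Reachable s a} *
      (prodBernoulli w).real ({ω : BondConfig V | ¬ (openGraph ω).Reachable s a} ∩
        ({ω | openEdgeCluster ω s ∈ 𝒜} ∩ (openConn x t ∩ {ω | ¬ (openGraph ω).Reachable t a}))) := by
  classical
  set μ := prodBernoulli w with hμ
  set R₁ : Set (BondConfig V) := {ω | ¬ (openGraph ω).Reachable s a} with hR₁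
  set R₂ : Set (BondConfig V) := {ω | ¬ (openGraph ω).Reachable t a} with hR₂
  set A : Set (BondConfig V) := {ω | openEdgeCluster ω s ∈ 𝒜} with hA
  set O₂ : Set (BondConfig V) := openConn x t with hO₂
  -- Step 1: glued PA in the world `{s,t} ↮ {a}` = `R₁ ∩ R₂`
  have hsS : s ∈ ({s, t} : Set V) := by simp
  have htS : t ∈ ({s, t} : Set V) := by simp
  have haT : a ∈ ({a} : Set V) := by simp
  have tA := typePlus_setOf_openEdgeCluster_mem ({s, t} : Set V) ({a} : Set V) hsS h𝒜
  have tO : ∀ ⦃ω ω' : BondConfig V⦄,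
      (⋃ u ∈ ({s, t} : Set V), openEdgeCluster ω u) ⊆ (⋃ u ∈ ({s, t} : Set V), openEdgeCluster ω' u) →
      (⋃ u ∈ ({a} : Set V), openEdgeCluster ω' u) ⊆ (⋃ u ∈ ({a} : Set V), openEdgeCluster ω u) →
      ω ∈ O₂ → ω' ∈ O₂ := by
    intro ω ω' hS hT h
    have h' : ω ∈ (openConn t x : Set (BondConfig V)) := (show (openGraph ω).Reachable x t from h).symm
    have := typePlus_openConn_of_mem ({s, t} : Set V) ({a} : Set V) htS x hS hT h'
    exact (show (openGraph ω').Reachable t x from this).symm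
  have h1 := setTwoClusterExchange w ({s, t} : Set V) ({a} : Set V)
    (A₁ := A) (A₂ := O₂) (B₁ := Set.univ) (B₂ := Set.univ) tA tO
    (fun _ _ _ _ h => h) (fun _ _ _ _ h => h)
  rw [sep_pair_singleton] at h1
  simp only [inter_univ] at h1
  -- Step 2: `A` and `R₂` positively correlated given `s ↮ a`
  have hsS' : s ∈ ({s} : Set V) := by simp
  have tA' := typePlus_setOf_openEdgeCluster_mem ({s} : Set V) ({a} : Set V) hsS' h𝒜
  have tR₂ : ∀ ⦃ω ω' : BondConfig V⦄,
      (⋃ u ∈ ({s} : Set V), openEdgeCluster ω u) ⊆ (⋃ u ∈ ({s} : Set V), openEdgeCluster ω' u) →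
      (⋃ u ∈ ({a} : Set V), openEdgeCluster ω' u) ⊆ (⋃ u ∈ ({a} : Set V), openEdgeCluster ω u) →
      ω ∈ R₂ → ω' ∈ R₂ := by
    intro ω ω' hS hT h
    have h' : ω ∈ (openConn a t : Set (BondConfig V))ᶜ := fun hat => h (hat.symm)
    have := typePlus_not_openConn_of_mem ({s} : Set V) ({a} : Set V) haT t hS hT h'
    exact fun hta => this hta.symm
  have h2 := setTwoClusterExchange w ({s} : Set V) ({a} : Set V)
    (A₁ := A) (A₂ := R₂) (B₁ := Set.univ) (B₂ := Set.univ) tA' tR₂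
    (fun _ _ _ _ h => h) (fun _ _ _ _ h => h)
  rw [sep_singleton_singleton] at h2
  simp only [inter_univ] at h2
  simp only [← hμ, ← hR₁, ← hR₂] at h1 h2
  have e1 : R₁ ∩ R₂ ∩ A = R₁ ∩ (A ∩ R₂) := by
    rw [inter_assoc, inter_comm R₂ A]
  have e2 : R₁ ∩ R₂ ∩ O₂ = R₁ ∩ (O₂ ∩ R₂) := by
    rw [inter_assoc, inter_comm R₂ O₂]
  have e3 : R₁ ∩ R₂ ∩ (A ∩ O₂) = R₁ ∩ (A ∩ (O₂ ∩ R₂)) := by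
    ext ω; simp only [mem_inter_iff]; tauto
  rw [e1, e2, e3] at h1
  have hnn : ∀ E : Set (BondConfig V), 0 ≤ μ.real E := fun E => measureReal_nonneg
  by_cases h0 : μ.real (R₁ ∩ R₂) = 0
  · have z : μ.real (R₁ ∩ (O₂ ∩ R₂)) = 0 := by
      apply measureReal_mono_null _ h0
      intro ω hω; exact ⟨hω.1, hω.2.2⟩
    rw [z, mul_zero]
    exact mul_nonneg (hnn _) (hnn _)
  · have hpos : 0 < μ.real (R₁ ∩ R₂) := lt_of_le_of_ne (hnn _) (Ne.symm h0)
    have k1 := mul_le_mul_of_nonneg_right h2 (hnn (R₁ ∩ (O₂ ∩ R₂)))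
    have k2 := mul_le_mul_of_nonneg_left h1 (hnn R₁)
    have : μ.real (R₁ ∩ R₂) * (μ.real (R₁ ∩ A) * μ.real (R₁ ∩ (O₂ ∩ R₂))) ≤
        μ.real (R₁ ∩ R₂) * (μ.real R₁ * μ.real (R₁ ∩ (A ∩ (O₂ ∩ R₂)))) := by
      nlinarith [k1, k2, hnn (R₁ ∩ A), hnn R₁]
    exact le_of_mul_le_mul_left this hpos

end UnionExchange

end Summit.CriticalPhenomena.PercolationContinuityZ3.Theorems
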